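import Mathlib.RingTheory.RootsOfUnity.AlgebraicallyClosed
import Literature.NumberTheory.GaloisRepresentations.SuperellipticLambdaTorsionCoprime
import Literature.NumberTheory.DiophantineGeometry.FunctionFieldHurwitzTame
import HarnessLib

/-!
# The genus of the superelliptic function field `Ω(x)[y]/(y^p - f(x))`, `p ∤ deg f`

Topic `Literature/NumberTheory/GaloisRepresentations` (the superelliptic curves `C_f : y^p = f(x)` of
`SuperellipticFunctionField` / `SuperellipticTorsionRep*` / `SuperellipticLambdaTorsionCoprime`).

For a prime `p`, a field `K`, `f ∈ K[X]` separable of degree `n ≥ 1` with `p ∤ n`, and an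
algebraically closed extension `Ω ⊇ K` in which `p ≠ 0`, the function field
`F = Ω(C_f) = Ω(x)[y]/(y^p - f(x))` has genus

  `g = (p - 1)(n - 1) / 2`   (`two_mul_genus_superelliptic`: `2g = (n - 1)(p - 1)`),

e.g. `g = 3` for the Picard curves `y³ = f₄(x)` (`genus_superelliptic_three_four`).  This is the
Riemann–Hurwitz count for the tame cyclic cover `x : C_f → ℙ¹` of degree `p`: it is totally ramified
at the `n` roots of `f` (`ramificationIdx_rootPlace`, `SuperellipticTorsionRepProofs`) and at `∞`
(`ramificationIdx_inftyPlace`, `SuperellipticLambdaTorsionCoprime`, as `p ∤ n`) and unramified elsewhere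
(`ramificationIdx_eq_one_of_eval_ne_zero`), so `2g - 2 = -2p + (n + 1)(p - 1)` (Stichtenoth,
*Algebraic Function Fields and Codes*, Prop. 3.7.3 (Kummer extensions) with Cor. 3.5.5; for these curves
Poonen–Schaefer 1997 §2 / Schaefer 1998 §3: "the curve `y^p = f(x)`, `p ∤ d = deg f`, has genus
`(p - 1)(d - 1)/2`").  The formalisation feeds the tree's **Riemann–Hurwitz formula for a tame function**
`AlgFunctionField.finsum_diffOrd_eq_of_forall_cast_ne_zero` (`FunctionFieldHurwitzTame`, all
characteristics) with the function `x`: `diffOrd_Q(x) = e_Q - 1` at the finite places (`= p - 1` at the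
root places `T_α`, `0` above the non-roots) and `diffOrd_{∞_C}(x) = v_{∞_C}(x) - 1 = -p - 1`.

## Main results (all proved, no named facts; axioms `propext`, `Classical.choice`, `Quot.sound`)

* `SuperellipticFunctionField.diffOrd_rootPlace_genX`, `diffOrd_genX_eq_zero_of_eval_ne_zero`,
  `diffOrd_inftyPlace_genX` — the three local computations;
* `SuperellipticFunctionField.eq_rootPlace_or_restrict_eq_or_eq_inftyPlace` — the trichotomy of places
  (root place / above a non-root / `∞_C`) over an algebraically closed field;
* `SuperellipticFunctionField.finsum_diffOrd_genX` — `∑_Q diffOrd_Q(x) = n(p - 1) - p - 1`;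
* `SuperellipticFunctionField.two_mul_genus_superelliptic` — **`2g(Ω(C_f)) = (n - 1)(p - 1)`**;
* `SuperellipticFunctionField.genus_superelliptic_three_four` — `g = 3` for `p = 3`, `n = 4` (Picard
  curves), the input `2g = 6` for the rank of the Tate module of the Picard Jacobian.

## References

* H. Stichtenoth, *Algebraic Function Fields and Codes*, 2nd ed., GTM 254 (2009), Prop. 3.7.3
  (ramification in Kummer extensions), Cor. 3.5.5 (Riemann–Hurwitz). [Stichtenoth2009]
* B. Poonen, E. F. Schaefer, *Explicit descent for Jacobians of cyclic covers of the projective line*,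
  J. reine angew. Math. 488 (1997), §2. [PoonenSchaefer1997]
* E. F. Schaefer, *Computing a Selmer group of a Jacobian using functions on the curve*, Math. Ann. 310
  (1998), §3. [Schaefer1998]
-/

noncomputable section

open Polynomial
open scoped Classical

namespace Literature.NumberTheory.GaloisRepresentations

open Literature.NumberTheory.DiophantineGeometry Literature.NumberTheory.DiophantineGeometry.AlgFunctionField

universe u v

namespace SuperellipticFunctionField

variable {K : Type u} [Field K] {L : Type v} [Field L] [Algebra K L] {p : ℕ} {f : K[X]}
variable [Fact (Irreducible (superellipticPoly K L p f))] [hp : Fact p.Prime]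

/-! ### The three local computations of `diffOrd_Q(x)` -/

/-- At a root place: `diffOrd_{T_α}(x) = v_{T_α}(x - α) - 1 = p - 1`. [cite: Stichtenoth2009, Prop. 3.7.3] -/
theorem diffOrd_rootPlace_genX (hsep : f.Separable) {α : L} (hα : (f.map (algebraMap K L)).IsRoot α) :
    (rootPlace K L p f α).diffOrd (genX K L p f) = p - 1 := by
  have hord := ord_rootPlace_genX_sub hsep hα (K := K) (L := L) (p := p)
  have hmem : genX K L p f - algebraMap L _ α ∈ (rootPlace K L p f α).ball 1 := by
    rw [PlaceOver.mem_ball_iff_le_ord _ _ (genX_sub_algebraMap_ne_zero K L p f α), hord]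
    exact_mod_cast hp.out.one_lt.le
  rw [PlaceOver.diffOrd_of_sub_algebraMap_mem _ hmem, hord]

/-- Above a non-root `β` (`f(β) ≠ 0`): `diffOrd_Q(x) = v_Q(x - β) - 1 = e(Q|P_β) - 1 = 0` (the cover is
unramified there; `Ω` algebraically closed with `p ≠ 0` in `Ω`, so that `μ_p(Ω)` has order `p`).
[cite: Stichtenoth2009, Prop. 3.7.3] -/
theorem diffOrd_genX_eq_zero_of_eval_ne_zero [IsAlgClosed L] (hpL : (p : L) ≠ 0) {β : L}
    (hβ : (f.map (algebraMap K L)).eval β ≠ 0) {Q : PlaceOver L (SuperellipticFunctionField K L p f)}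
    (hQ : Q.restrict (K := L) (F := RatFunc L) = placeXSubC β) : Q.diffOrd (genX K L p f) = 0 := by
  haveI : NeZero (p : L) := ⟨hpL⟩
  obtain ⟨ζ₀, hζ₀⟩ := HasEnoughRootsOfUnity.exists_primitiveRoot L p
  have he : ramificationIdx K L p f Q = 1 := ramificationIdx_eq_one_of_eval_ne_zero hζ₀ hβ hQ
  have hord : Q.ord (genX K L p f - algebraMap L _ β) = 1 := by
    rw [ord_genX_sub_algebraMap, hQ, ord_placeXSubC_X_sub_C, mul_one, he]
  have hmem : genX K L p f - algebraMap L _ β ∈ Q.ball 1 := by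
    rw [PlaceOver.mem_ball_iff_le_ord _ _ (genX_sub_algebraMap_ne_zero K L p f β), hord]
  rw [PlaceOver.diffOrd_of_sub_algebraMap_mem _ hmem, hord, sub_self]

/-- At infinity (`p ∤ deg f`): `diffOrd_{∞_C}(x) = v_{∞_C}(x) - 1 = -p - 1`. [cite: Stichtenoth2009, Prop. 3.7.3] -/
theorem diffOrd_inftyPlace_genX (hndvd : ¬ p ∣ f.natDegree) :
    (inftyPlace K L p f).diffOrd (genX K L p f) = -(p : ℤ) - 1 := by
  have hord := ord_inftyPlace_genX (K := K) (L := L) hndvd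
  rw [PlaceOver.diffOrd_of_ord_neg, hord]
  rw [hord, neg_lt_zero]
  exact_mod_cast hp.out.pos

/-! ### Summing over the places -/

variable [IsAlgClosed L]

/-- The trichotomy of places of `Ω(C_f)` over an algebraically closed `Ω` (`p ∤ deg f`): a root place
`T_α`, a place above a non-root `β`, or `∞_C`. [folklore] -/
theorem eq_rootPlace_or_restrict_eq_or_eq_inftyPlace (hsep : f.Separable) (hndvd : ¬ p ∣ f.natDegree)
    (Q : PlaceOver L (SuperellipticFunctionField K L p f)) :
    (∃ α, (f.map (algebraMap K L)).IsRoot α ∧ Q = rootPlace K L p f α) ∨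
      (∃ β, (f.map (algebraMap K L)).eval β ≠ 0 ∧ Q.restrict (K := L) (F := RatFunc L) = placeXSubC β) ∨
      Q = inftyPlace K L p f := by
  rcases eq_ratFuncInftyPlace_or_exists_eq_placeXSubC L (Q.restrict (K := L) (F := RatFunc L)) with h | ⟨b, hb⟩
  · exact Or.inr (Or.inr (eq_inftyPlace_of_restrict_eq hndvd h))
  · by_cases hfb : (f.map (algebraMap K L)).eval b = 0
    · exact Or.inl ⟨b, hfb, eq_rootPlace_of_restrict_eq hsep hfb hb⟩
    · exact Or.inr (Or.inl ⟨b, hfb, hb⟩)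

/-- **`∑_Q diffOrd_Q(x) = n(p - 1) - (p + 1)`** for `Ω(C_f)`, `n = deg f`, `p ∤ n`, `p ≠ 0` in `Ω`.
[cite: Stichtenoth2009, Prop. 3.7.3, Cor. 3.5.5] -/
theorem finsum_diffOrd_genX (hpL : (p : L) ≠ 0) (hsep : f.Separable) (hndvd : ¬ p ∣ f.natDegree) :
    ∑ᶠ Q : PlaceOver L (SuperellipticFunctionField K L p f), Q.diffOrd (genX K L p f) =
      (f.natDegree : ℤ) * (p - 1) - (p + 1) := by
  have hf : f ≠ 0 := ne_zero_of_not_dvd_natDegree hndvd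
  -- the sum is supported on the root places and `∞_C`
  have hsupp : (Function.support fun Q : PlaceOver L (SuperellipticFunctionField K L p f) =>
      Q.diffOrd (genX K L p f)) ⊆
        (insert (inftyPlace K L p f) ((f.rootSet L).toFinset.image (rootPlace K L p f)) : Finset _) := by
    intro Q hQ
    rw [Function.mem_support] at hQ
    simp only [Finset.coe_insert, Finset.coe_image, Set.coe_toFinset, Set.mem_insert_iff, Set.mem_image]
    rcases eq_rootPlace_or_restrict_eq_or_eq_inftyPlace hsep hndvd Q with ⟨α, hα, rfl⟩ | ⟨β, hβ, hQβ⟩ | h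
    · exact Or.inr ⟨α, mem_rootSet_of_isRoot hf hα, rfl⟩
    · exact absurd (diffOrd_genX_eq_zero_of_eval_ne_zero hpL hβ hQβ) hQ
    · exact Or.inl h
  rw [finsum_eq_sum_of_support_subset _ hsupp, Finset.sum_insert, Finset.sum_image]
  · rw [diffOrd_inftyPlace_genX hndvd]
    have hroot : ∀ α ∈ (f.rootSet L).toFinset, (rootPlace K L p f α).diffOrd (genX K L p f) = (p : ℤ) - 1 :=
      fun α hα => diffOrd_rootPlace_genX hsep (isRoot_of_mem_rootSet (Set.mem_toFinset.mp hα))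
    rw [Finset.sum_congr rfl hroot, Finset.sum_const, Set.toFinset_card, card_rootSet hsep, nsmul_eq_mul]
    ring
  · exact fun α _ β _ h => rootPlace_injective h
  · rw [Finset.mem_image]
    rintro ⟨α, -, hα⟩
    exact inftyPlace_ne_rootPlace α hα.symm

/-- **The genus of `Ω(C_f)`, `C_f : y^p = f(x)`**: for `f ∈ K[X]` separable of degree `n` with `p ∤ n`
and an algebraically closed `Ω ⊇ K` with `p ≠ 0` in `Ω`, `2·g(Ω(C_f)/Ω) = (n - 1)(p - 1)`
(Riemann–Hurwitz for the tame cyclic cover `x : C_f → ℙ¹`: totally ramified at the `n` roots and at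
`∞`, unramified elsewhere).  Poonen–Schaefer: "the genus of `y^p = f(x)`, `p ∤ d = deg f`, is
`(p - 1)(d - 1)/2`". [cite: Stichtenoth2009, Prop. 3.7.3, Cor. 3.5.5] [cite: PoonenSchaefer1997, §2]
[cite: Schaefer1998, §3] -/
theorem two_mul_genus_superelliptic (hpL : (p : L) ≠ 0) (hsep : f.Separable) (hndvd : ¬ p ∣ f.natDegree) :
    2 * genus L (SuperellipticFunctionField K L p f) = (f.natDegree - 1) * (p - 1) := by
  have hx : genX K L p f ∉ Set.range (algebraMap L (SuperellipticFunctionField K L p f)) := by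
    rintro ⟨c, hc⟩
    exact transcendental_genX (K := K) (L := L) (p := p) (f := f) (hc ▸ isAlgebraic_algebraMap c)
  have hnK : ∀ Q : PlaceOver L (SuperellipticFunctionField K L p f),
      (((Q.diffOrd (genX K L p f) + 1 : ℤ)) : L) ≠ 0 := by
    intro Q
    rcases eq_rootPlace_or_restrict_eq_or_eq_inftyPlace hsep hndvd Q with ⟨α, hα, rfl⟩ | ⟨β, hβ, hQβ⟩ | rfl
    · rw [diffOrd_rootPlace_genX hsep hα, sub_add_cancel]
      exact_mod_cast hpL
    · rw [diffOrd_genX_eq_zero_of_eval_ne_zero hpL hβ hQβ, zero_add, Int.cast_one]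
      exact one_ne_zero
    · rw [diffOrd_inftyPlace_genX hndvd, sub_add_cancel, Int.cast_neg, neg_ne_zero]
      exact_mod_cast hpL
  haveI := isIntegrallyClosedIn_of_isAlgClosed (K := L) (F := SuperellipticFunctionField K L p f)
  have hRH := finsum_diffOrd_eq_of_forall_cast_ne_zero (K := L) (F := SuperellipticFunctionField K L p f)
    PlaceOver.isRational_of_isAlgClosed hx hnK
  rw [finsum_diffOrd_genX hpL hsep hndvd] at hRH
  have hn : 1 ≤ f.natDegree := by
    rcases Nat.eq_zero_or_pos f.natDegree with h | h
    · exact absurd (h ▸ dvd_zero p) hndvd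
    · exact h
  have hp1 : 1 ≤ p := hp.out.one_lt.le
  zify [hn, hp1]
  linarith

/-- **The Picard curves `y³ = f₄(x)` have genus `3`**: for `f` separable of degree `4` and an
algebraically closed `Ω ⊇ K` of characteristic `≠ 3`, `g(Ω(C_f)) = 3` (`2g = 3 · 2`).
[cite: Schaefer1998, §3] [cite: Stichtenoth2009, Prop. 3.7.3, Cor. 3.5.5] -/
theorem genus_superelliptic_three_four {f : K[X]} [Fact (Irreducible (superellipticPoly K L 3 f))]
    (h3 : (3 : L) ≠ 0) (hsep : f.Separable) (hdeg : f.natDegree = 4) :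
    genus L (SuperellipticFunctionField K L 3 f) = 3 := by
  haveI : Fact (Nat.Prime 3) := ⟨Nat.prime_three⟩
  have h := two_mul_genus_superelliptic (K := K) (L := L) (p := 3) (f := f) (by exact_mod_cast h3) hsep
    (by rw [hdeg]; decide)
  rw [hdeg] at h
  omega

end SuperellipticFunctionField

end Literature.NumberTheory.GaloisRepresentations
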